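import Summits.HubbardSuperconductivity.HubbardSuperconductivity.Theorems.AbsenceCertificateConditionalRefutation
import Literature.MathematicalPhysics.QuantumLattice.DWaveSourceProofs
import Literature.MathematicalPhysics.QuantumLattice.DWaveOrderParameterProofs

/-!
# STRATEGY CENSUS (Lean part) for crux `UniversalSourcedVanishing` (stmt-HubbardSuperconductivity-9485),
# route `AbsenceCertificate` — crux-strategist, RESTATED re-audit (BC2 redirect attempt)

`X := UniversalSourcedVanishing = ∀ U > 0, ∀ δ ∈ (0,1/2), ∃ μ, CS U δ μ ∧ SV U μ` (clause (a) canonical support,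
clause (b) sourced `d`-wave vanishing). This scratch file records, for the decompositions D1–D7 of the census,
the Lean facts that decide criteria (b) [assembly non-trivial] and (c) [no piece equivalent to X or S]:

* D1 clause split `CSP ∧ Global → X`: the assembly is the landed 3-line glue and `Global → X` is ONE line from
  landed theorems ⇒ violates (b) and (c).
* D2 regime split in `U`: assembly is a one-line case split ⇒ violates (b).
* D3 energy (Griffiths) form `X_E`: `X ↔ X_E` from LANDED Literature sandwich lemmas ⇒ violates (c).
* D4 one-source form `SV₁` (vanishing at ONE h per η): `SV₁ ↔ SV` from LANDED monotonicity ⇒ violates (c);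
  by-product: the `∀ h ∈ (0,h₀)` quantifier of clause (b) is redundant.
* D5 order-parameter form: `X → X_op` cheap (shown); converse = energy-density limit + sandwich (landed
  `dlst_source_energyDensity_limit`, `dWaveSourceDensity_le_energyDrop_div`) ⇒ equivalent modulo landed theorems.
* D6 `NoLRO`-everywhere piece: `NoLRO → ¬S` in 4 lines from the landed existence of admissible sequences ⇒ the
  piece is at least the route's target ⇒ violates (c).
* D7 compressible/plateau dichotomy: assembly = excluded middle on uniqueness of the supporting μ ⇒ violates
  (b); both pieces are `X` with an extra hypothesis.
No `sorry`; nothing here is proposed to the tree.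
-/

set_option linter.dupNamespace false
set_option linter.unusedVariables false

noncomputable section

namespace Summit.HubbardSuperconductivity.HubbardSuperconductivity.Cruxes.UniversalSourcedVanishing.Census

open Matrix Filter Literature.MathematicalPhysics.QuantumLattice Literature.Probability.LatticeModels
open Summit.HubbardSuperconductivity.HubbardSuperconductivity.Theses.AbsenceCertificate
open Summit.HubbardSuperconductivity.HubbardSuperconductivity.Theorems
open Summit.HubbardSuperconductivity.HubbardSuperconductivity.Theorems.AbsenceCertificate
open scoped ComplexOrder Topology

/-- Clause (a): `μ` canonically supports `(U, δ)`. -/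
def CS (U δ μ : ℝ) : Prop :=
  ∀ ε : ℝ, 0 < ε → ∃ L₀ : ℕ, ∀ L : ℕ, Even L → L₀ ≤ L →
    |(hubbardTorus 2 L 1 U).minEnergyOn (szSector (2 * ⌊(1 - δ) * (L : ℝ) ^ 2 / 2⌋₊) 0)
      - μ * ((2 * ⌊(1 - δ) * (L : ℝ) ^ 2 / 2⌋₊ : ℕ) : ℝ)
      - (hubbardTorusWith 2 L 1 U μ).groundEnergy| ≤ ε * (L : ℝ) ^ 2

/-- Clause (b): sourced `d`-wave vanishing at `(U, μ)`. -/
def SV (U μ : ℝ) : Prop :=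
  ∀ η : ℝ, 0 < η → ∃ h₀ : ℝ, 0 < h₀ ∧ ∀ h : ℝ, h ∈ Set.Ioo (0:ℝ) h₀ →
    ∃ L₀ : ℕ, ∀ (L : ℕ) [NeZero L], L₀ ≤ L → dWaveSourceDensity L U μ h ≤ η

/-- Read-back of the crux. -/
theorem X_iff : UniversalSourcedVanishing ↔
    ∀ U : ℝ, 0 < U → ∀ δ : ℝ, δ ∈ Set.Ioo (0:ℝ) (1 / 2) → ∃ μ : ℝ, CS U δ μ ∧ SV U μ :=
  Iff.rfl

/-! ### Landed signals on X itself -/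

/-- `X → ¬S` is LANDED (the route's chain): X is at least the route's target. -/
theorem X_implies_notS : UniversalSourcedVanishing → ¬ _root_.HubbardSuperconductivity :=
  not_hubbardSuperconductivity_of_universalSourcedVanishing

/-! ### D1 — clause split `CSP ∧ Global → X` -/

/-- D1 assembly: the landed 3-line glue. -/
theorem D1_assembly : CanonicalSupportingPotential → GlobalSourcedVanishing → UniversalSourcedVanishing :=
  universalSourcedVanishingGlue_proof

/-- D1 (c)-violation: the piece `GlobalSourcedVanishing` implies X in ONE line from landed theorems. -/
theorem D1_global_implies_X : GlobalSourcedVanishing → UniversalSourcedVanishing :=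
  universalSourcedVanishingGlue_proof canonicalSupportingPotential_proof

/-! ### D2 — regime split in the coupling -/

/-- X restricted to couplings in `S`. -/
def XOn (S : Set ℝ) : Prop :=
  ∀ U : ℝ, 0 < U → U ∈ S → ∀ δ : ℝ, δ ∈ Set.Ioo (0:ℝ) (1 / 2) → ∃ μ : ℝ, CS U δ μ ∧ SV U μ

/-- D2 assembly is a one-liner (trivial seam). -/
theorem D2_assembly (U₀ : ℝ) (h₁ : XOn (Set.Iic U₀)) (h₂ : XOn (Set.Ioi U₀)) :
    UniversalSourcedVanishing :=
  fun U hU δ hδ => (le_or_gt U U₀).elim (fun h => h₁ U hU h δ hδ) (fun h => h₂ U hU h δ hδ)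

/-- … and each piece is X with an extra hypothesis. -/
theorem D2_X_to_piece (S : Set ℝ) : UniversalSourcedVanishing → XOn S :=
  fun h U hU _ δ hδ => h U hU δ hδ

/-! ### D3 — energy (Griffiths) reformulation -/

/-- Energy-slope vanishing at `(U, μ)`: the pair source lowers the grand-canonical ground energy only
sub-linearly, `E_L(0) - E_L(h) ≤ η h L²`. -/
def EV (U μ : ℝ) : Prop :=
  ∀ η : ℝ, 0 < η → ∃ h₀ : ℝ, 0 < h₀ ∧ ∀ h : ℝ, h ∈ Set.Ioo (0:ℝ) h₀ →
    ∃ L₀ : ℕ, ∀ (L : ℕ) [NeZero L], L₀ ≤ L →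
      (dWaveSourceTorus L U μ 0).groundEnergy - (dWaveSourceTorus L U μ h).groundEnergy ≤
        η * h * (L : ℝ) ^ 2

/-- The energy form of X. -/
def X_E : Prop :=
  ∀ U : ℝ, 0 < U → ∀ δ : ℝ, δ ∈ Set.Ioo (0:ℝ) (1 / 2) → ∃ μ : ℝ, CS U δ μ ∧ EV U μ

theorem SV_to_EV (U μ : ℝ) : SV U μ → EV U μ := by
  intro h η hη
  obtain ⟨h₀, hh₀, H⟩ := h (η / 2) (by positivity)
  refine ⟨h₀, hh₀, fun s hs => ?_⟩
  obtain ⟨L₀, HL⟩ := H s hs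
  refine ⟨L₀, fun L _ hL => ?_⟩
  have h1 := groundEnergy_gain_le_dWaveSourceDensity (L := L) U μ s
  have h2 := HL L hL
  have hs0 : 0 ≤ s := hs.1.le
  have hpos : 0 ≤ 2 * s * (L : ℝ) ^ 2 := by positivity
  calc (dWaveSourceTorus L U μ 0).groundEnergy - (dWaveSourceTorus L U μ s).groundEnergy
      ≤ 2 * s * (L : ℝ) ^ 2 * dWaveSourceDensity L U μ s := h1
    _ ≤ 2 * s * (L : ℝ) ^ 2 * (η / 2) := mul_le_mul_of_nonneg_left h2 hpos
    _ = η * s * (L : ℝ) ^ 2 := by ring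

theorem EV_to_SV (U μ : ℝ) : EV U μ → SV U μ := by
  intro h η hη
  obtain ⟨h₀, hh₀, H⟩ := h η hη
  refine ⟨h₀ / 2, by positivity, fun s hs => ?_⟩
  have h2s : 2 * s ∈ Set.Ioo (0:ℝ) h₀ := ⟨by linarith [hs.1], by linarith [hs.2]⟩
  obtain ⟨L₀, HL⟩ := H (2 * s) h2s
  refine ⟨L₀, fun L _ hL => ?_⟩
  have hdrop := dWaveSourceDensity_mul_le_groundEnergy_drop (L := L) U μ s (2 * s)
  have hle0 := groundEnergy_dWaveSourceTorus_le (L := L) U μ s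
  have hE := HL L hL
  have hs0 : 0 < s := hs.1
  have hL2 : (0 : ℝ) < (L : ℝ) ^ 2 := cast_sq_pos_of_neZero L
  have step : (2 * s * (L : ℝ) ^ 2) * dWaveSourceDensity L U μ s ≤ (2 * s * (L : ℝ) ^ 2) * η := by
    have e1 : (2 * s * (L : ℝ) ^ 2) * dWaveSourceDensity L U μ s =
        (2 * s - s) * (2 * (L : ℝ) ^ 2 * dWaveSourceDensity L U μ s) := by ring
    have e2 : η * (2 * s) * (L : ℝ) ^ 2 = (2 * s * (L : ℝ) ^ 2) * η := by ring
    rw [e1, ← e2]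
    linarith [hdrop, hle0, hE]
  exact le_of_mul_le_mul_left step (by positivity)

/-- D3 (c)-violation: the energy form is EQUIVALENT to X by landed Literature lemmas. -/
theorem D3_equiv : UniversalSourcedVanishing ↔ X_E := by
  constructor
  · intro hX U hU δ hδ
    obtain ⟨μ, hcs, hsv⟩ := hX U hU δ hδ
    exact ⟨μ, hcs, SV_to_EV U μ hsv⟩
  · intro hX U hU δ hδ
    obtain ⟨μ, hcs, hev⟩ := hX U hU δ hδ
    exact ⟨μ, hcs, EV_to_SV U μ hev⟩

/-! ### D4 — one-source form (monotonicity in `h`) -/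

/-- Vanishing at ONE source strength per `η`. -/
def SV₁ (U μ : ℝ) : Prop :=
  ∀ η : ℝ, 0 < η → ∃ h : ℝ, 0 < h ∧ ∃ L₀ : ℕ, ∀ (L : ℕ) [NeZero L], L₀ ≤ L →
    dWaveSourceDensity L U μ h ≤ η

/-- D4 (c)-violation: `SV₁ ↔ SV` by landed monotonicity `dWaveSourceDensity_mono`
(so the `∀ h ∈ (0, h₀)` of clause (b) is redundant). -/
theorem SV₁_iff (U μ : ℝ) : SV₁ U μ ↔ SV U μ := by
  constructor
  · intro h η hη
    obtain ⟨h₁, hh₁, L₀, HL⟩ := h η hη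
    refine ⟨h₁, hh₁, fun s hs => ⟨L₀, fun L _ hL => ?_⟩⟩
    exact (dWaveSourceDensity_mono U μ hs.2.le).trans (HL L hL)
  · intro h η hη
    obtain ⟨h₀, hh₀, H⟩ := h η hη
    obtain ⟨L₀, HL⟩ := H (h₀ / 2) ⟨by positivity, by linarith⟩
    exact ⟨h₀ / 2, by positivity, L₀, HL⟩

def X₁ : Prop :=
  ∀ U : ℝ, 0 < U → ∀ δ : ℝ, δ ∈ Set.Ioo (0:ℝ) (1 / 2) → ∃ μ : ℝ, CS U δ μ ∧ SV₁ U μ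

theorem D4_equiv : UniversalSourcedVanishing ↔ X₁ := by
  constructor
  · intro hX U hU δ hδ
    obtain ⟨μ, hcs, hsv⟩ := hX U hU δ hδ
    exact ⟨μ, hcs, (SV₁_iff U μ).2 hsv⟩
  · intro hX U hU δ hδ
    obtain ⟨μ, hcs, h1⟩ := hX U hU δ hδ
    exact ⟨μ, hcs, (SV₁_iff U μ).1 h1⟩

/-! ### D5 — order-parameter form -/

/-- X in Koma–Tasaki order-parameter language (liminf form). -/
def X_op : Prop :=
  ∀ U : ℝ, 0 < U → ∀ δ : ℝ, δ ∈ Set.Ioo (0:ℝ) (1 / 2) → ∃ μ : ℝ, CS U δ μ ∧ dWaveOrderParameter U μ = 0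

theorem SV_to_op (U μ : ℝ) (h : SV U μ) : dWaveOrderParameter U μ = 0 := by
  refine le_antisymm ?_ (dWaveOrderParameter_nonneg U μ)
  refine le_of_forall_pos_le_add fun η hη => ?_
  rw [zero_add]
  obtain ⟨h₀, hh₀, H⟩ := h η hη
  obtain ⟨L₀, HL⟩ := H (h₀ / 2) ⟨by positivity, by linarith⟩
  refine (dWaveOrderParameter_le_liminf U μ (h := h₀ / 2) (by positivity)).trans ?_
  refine liminf_le_of_frequently_le ?_ ?_
  · refine (eventually_atTop.2 ⟨L₀, fun L hL => ?_⟩).frequently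
    exact HL (L + 1) (by omega)
  · exact isBoundedUnder_of_eventually_ge
      (Eventually.of_forall fun L => dWaveSourceDensity_nonneg U μ (by positivity))

/-- D5, cheap direction: `X → X_op` (the converse is the energy-density-limit + sandwich argument over the
landed `dlst_source_energyDensity_limit`; together: equivalent modulo landed theorems). -/
theorem D5_X_to_op : UniversalSourcedVanishing → X_op := by
  intro hX U hU δ hδ
  obtain ⟨μ, hcs, hsv⟩ := hX U hU δ hδ
  exact ⟨μ, hcs, SV_to_op U μ hsv⟩

/-! ### D6 — `SSB ⇒ LRO` (Koma–Tasaki conjecture direction) ∧ `NoLRO` everywhere -/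

/-- No admissible ground-state sequence has `d`-wave pair-field LRO, at any `(U, δ)` of the box. -/
def NoLRO : Prop :=
  ∀ U : ℝ, 0 < U → ∀ δ : ℝ, δ ∈ Set.Ioo (0:ℝ) (1 / 2) →
    ∀ (N : ℕ → ℕ) (ψ : ∀ L, Fock (Orb (FermionTorus 2 L))),
      (∀ L, Even L → N L = 2 * ⌊(1 - δ) * (L : ℝ) ^ 2 / 2⌋₊ ∧ star (ψ L) ⬝ᵥ ψ L = 1 ∧
          IsGroundStateInSector (hubbardTorus 2 L 1 U) (N L) 0 (ψ L)) →
        ¬ HasLongRangeOrder (fun k => halfOpenBox 2 (2 * k))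
            (fun k => torusPullback (pairFieldCorr dWaveFormFactor ψ) (2 * k))

/-- `SSB ⇒ LRO` for this model (the open Koma–Tasaki direction), in contrapositive-ready form. -/
def SsbForcesLRO : Prop :=
  ∀ U : ℝ, 0 < U → ∀ δ : ℝ, δ ∈ Set.Ioo (0:ℝ) (1 / 2) → ∀ μ : ℝ, CS U δ μ → ¬ SV U μ →
    ∃ (N : ℕ → ℕ) (ψ : ∀ L, Fock (Orb (FermionTorus 2 L))),
      (∀ L, Even L → N L = 2 * ⌊(1 - δ) * (L : ℝ) ^ 2 / 2⌋₊ ∧ star (ψ L) ⬝ᵥ ψ L = 1 ∧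
          IsGroundStateInSector (hubbardTorus 2 L 1 U) (N L) 0 (ψ L)) ∧
        HasLongRangeOrder (fun k => halfOpenBox 2 (2 * k))
            (fun k => torusPullback (pairFieldCorr dWaveFormFactor ψ) (2 * k))

/-- D6 assembly: six lines of logic over the landed CSP (modus tollens seam). -/
theorem D6_assembly (h₁ : SsbForcesLRO) (h₂ : NoLRO) : UniversalSourcedVanishing := by
  intro U hU δ hδ
  obtain ⟨μ, hμ⟩ := canonicalSupportingPotential_proof U δ ⟨hδ.1, hδ.2.trans (by norm_num)⟩
  refine ⟨μ, hμ, ?_⟩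
  by_contra hsv
  obtain ⟨N, ψ, hadm, hlro⟩ := h₁ U hU δ hδ μ hμ hsv
  exact h₂ U hU δ hδ N ψ hadm hlro

/-- D6 (c)-violation: the piece `NoLRO` alone implies the route's target `¬S` in four lines
(landed existence of admissible sequences). -/
theorem D6_noLRO_implies_notS : NoLRO → ¬ _root_.HubbardSuperconductivity := by
  intro h hS
  obtain ⟨U, hU, δ, hδ, hall⟩ := (_root_.HubbardSuperconductivity_iff).1 hS
  obtain ⟨N, ψ, hNψ⟩ := Summit.HubbardSuperconductivity.NoGo.exists_groundStateInSector_seq 1 U δ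
    (by linarith [hδ.1])
  exact h U hU δ hδ N ψ (fun L _ => hNψ L) (hall N ψ fun L _ => hNψ L)

/-! ### D7 — compressible / plateau dichotomy on the supporting potential -/

/-- At dopings with a UNIQUE supporting potential, X. -/
def Xuniq : Prop :=
  ∀ U : ℝ, 0 < U → ∀ δ : ℝ, δ ∈ Set.Ioo (0:ℝ) (1 / 2) →
    (∀ μ μ' : ℝ, CS U δ μ → CS U δ μ' → μ = μ') → ∃ μ : ℝ, CS U δ μ ∧ SV U μ

/-- At plateau dopings (two distinct supporting potentials), X. -/
def Xplat : Prop :=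
  ∀ U : ℝ, 0 < U → ∀ δ : ℝ, δ ∈ Set.Ioo (0:ℝ) (1 / 2) →
    (∃ μ μ' : ℝ, μ ≠ μ' ∧ CS U δ μ ∧ CS U δ μ') → ∃ μ : ℝ, CS U δ μ ∧ SV U μ

/-- D7 assembly = excluded middle (trivial seam). -/
theorem D7_assembly (h₁ : Xuniq) (h₂ : Xplat) : UniversalSourcedVanishing := by
  intro U hU δ hδ
  by_cases huniq : ∀ μ μ' : ℝ, CS U δ μ → CS U δ μ' → μ = μ'
  · exact h₁ U hU δ hδ huniq
  · push Not at huniq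
    obtain ⟨μ, μ', h, h', hne⟩ := huniq
    exact h₂ U hU δ hδ ⟨μ, μ', hne, h, h'⟩

/-- … and both pieces are X with an extra hypothesis. -/
theorem D7_X_to_uniq : UniversalSourcedVanishing → Xuniq := fun h U hU δ hδ _ => h U hU δ hδ
theorem D7_X_to_plat : UniversalSourcedVanishing → Xplat := fun h U hU δ hδ _ => h U hU δ hδ

/-- D7′ (interval form): on a plateau, vanishing SOMEWHERE in the supporting interval — logically
incomparable with X; its seam needs only `SupportConvex` below. -/
def XplatInt : Prop :=
  ∀ U : ℝ, 0 < U → ∀ δ : ℝ, δ ∈ Set.Ioo (0:ℝ) (1 / 2) → ∀ μ₁ μ₂ : ℝ, μ₁ < μ₂ →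
    CS U δ μ₁ → CS U δ μ₂ → ∃ μ ∈ Set.Icc μ₁ μ₂, SV U μ

/-- The only content of the D7′ seam: supporting potentials form an interval (convexity of
`μ ↦ E_sec − μN_L − E₀(H − μN)`, from the landed `concaveOn_groundEnergy_hubbardTorusWith` and the sector
variational principle). Stated, not proved here. -/
def SupportConvex : Prop :=
  ∀ (U δ μ₁ μ₂ μ : ℝ), CS U δ μ₁ → CS U δ μ₂ → μ ∈ Set.Icc μ₁ μ₂ → CS U δ μ

/-- D7′ assembly modulo `SupportConvex`: still an excluded-middle skeleton (12 lines of logic). -/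
theorem D7'_assembly (hc : SupportConvex) (h₁ : Xuniq) (h₂ : XplatInt) : UniversalSourcedVanishing := by
  intro U hU δ hδ
  by_cases huniq : ∀ μ μ' : ℝ, CS U δ μ → CS U δ μ' → μ = μ'
  · exact h₁ U hU δ hδ huniq
  · push Not at huniq
    obtain ⟨μ, μ', h, h', hne⟩ := huniq
    rcases lt_or_gt_of_ne hne with hlt | hgt
    · obtain ⟨ν, hν, hsv⟩ := h₂ U hU δ hδ μ μ' hlt h h'
      exact ⟨ν, hc U δ μ μ' ν h h' hν, hsv⟩
    · obtain ⟨ν, hν, hsv⟩ := h₂ U hU δ hδ μ' μ hgt h' h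
      exact ⟨ν, hc U δ μ' μ ν h' h hν, hsv⟩

end Summit.HubbardSuperconductivity.HubbardSuperconductivity.Cruxes.UniversalSourcedVanishing.Census
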